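import Mathlib
import Literature.Geometry.Lorentzian.Basic
import Literature.Geometry.Lorentzian.KerrEnergyIdentity
import Literature.Analysis.FunctionSpaces.ParametricIntegralSmooth
import Summits.FinalStateConjecture.FinalStateConjecture.Theorems.PhotonSphereChannelsBlindnessWaveCalculus
import Summits.FinalStateConjecture.FinalStateConjecture.Theorems.StarvedNecksNecksCertifyStubCharacteristicCalculus
import Summits.FinalStateConjecture.FinalStateConjecture.Theorems.StarvedNecksNecksCertifyStubSphericalMeansCalculus
import Summits.FinalStateConjecture.FinalStateConjecture.Theorems.StarvedNecksNecksCertifyStubSphereMeanDarbouxHelpers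
import Summits.FinalStateConjecture.FinalStateConjecture.Theorems.StarvedNecksNecksCertifyStubKirchhoffFormula
import Summits.FinalStateConjecture.FinalStateConjecture.Theorems.StarvedNecksNecksCertifyStrongHuygens
import Summits.FinalStateConjecture.FinalStateConjecture.Theorems.EIHFluxBalanceModulatedKerrHandoffStubSphericalMeansCalculusC2

/-!
# Far-cone retardation remainder, IX: the Kirchhoff–Duhamel formula with zero data (equality form)

Support file 9 for the brick `SoftEraTubeLift.FarConeRetardationRemainder` of crux
`EIHFluxBalance.ModulatedKerrHandoff` (H′, stmt-FinalStateConjecture-17402; card `soft-era-tube-lift`).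
For a `C²` solution of `u_tt − Δu = f` on `ℝ¹⁺³` (iterated-`deriv` convention) with zero Cauchy
data at `t = 1`:
`u(t, x) = σ(S²)⁻¹ ∫₀^{t−1} s ∫_{S²} f(t − s, x + s w) dσ(w) ds`  (`t ≥ 1`)
(`kirchhoff_duhamel_eq`; Evans, *PDE*, §2.4.1(c), §2.4.2).  This is the EQUALITY behind the
landed comparison inequality `…Theorems.EIHFluxBalance.ConeRatesAreILED.stub_kirchhoffComparisonC2`
(whose proof derives it privately and then takes absolute values); the private `C²` transport
lemmas of that file are re-run here verbatim (adapted from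
`…Theorems/EIHFluxBalanceModulatedKerrHandoffStubKirchhoffComparisonC2.lean`), the spherical-means
calculus being the landed `…ConeRatesAreILED.stub_sphericalMeansCalculusC2`. [folklore]
-/

noncomputable section

open scoped Manifold ContDiff Topology ENNReal BigOperators
open Filter Set MeasureTheory Metric Function Literature.Geometry.Lorentzian

-- the doubled `FinalStateConjecture.FinalStateConjecture` path component trips dupNamespace
set_option linter.dupNamespace false
set_option linter.style.longLine false

namespace Summit.FinalStateConjecture.FinalStateConjecture.Theorems.EIHFluxBalance.ModulatedKerrHandoffBricks.FarCone

open Literature.Analysis.FunctionSpaces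
open Summit.FinalStateConjecture.FinalStateConjecture.Theorems.Blindness
open Summit.FinalStateConjecture.FinalStateConjecture.Theorems.NecksCertifyBargmann.Calculus
open Summit.FinalStateConjecture.FinalStateConjecture.Theorems.NecksCertifyTwoCap.SphericalMeans
open Summit.FinalStateConjecture.FinalStateConjecture.Theorems.NecksCertifyTwoCap.Kirchhoff
open Summit.FinalStateConjecture.FinalStateConjecture.Theorems.NecksCertifyTwoCap.Propagation
open Summit.FinalStateConjecture.FinalStateConjecture.Theorems.EIHFluxBalance.ConeRatesAreILED

/-! ### Slice dictionary: `deriv` along time lines and coordinate space lines of `E4` -/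

/-- Chain rule along the time line `s ↦ (s, y)`: `d/ds φ(s, y) = ∂₀φ(s, y)`. [folklore] -/
private theorem deriv_comp_ofTimeSpace_time {φ : E4 → ℝ} (hφ : Differentiable ℝ φ) (s : ℝ)
    (y : E3) :
    deriv (fun s' : ℝ ↦ φ (E4.ofTimeSpace s' y)) s =
      fderiv ℝ φ (E4.ofTimeSpace s y) (E4.basisVector 0) :=
  ((hφ _).hasFDerivAt.comp_hasDerivAt s (hasDerivAt_ofTimeSpace_time y s)).deriv

/-- Second time derivative of the slices of a `C²` function: `d²/ds² ψ(s, y) = ∂₀∂₀ψ(s, y)`.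
[folklore] -/
private theorem deriv_deriv_comp_ofTimeSpace_time {ψ : E4 → ℝ} (hψ : ContDiff ℝ 2 ψ) (τ : ℝ)
    (y : E3) :
    deriv (fun s ↦ deriv (fun s' ↦ ψ (E4.ofTimeSpace s' y)) s) τ =
      fderiv ℝ (fun z ↦ fderiv ℝ ψ z (E4.basisVector 0)) (E4.ofTimeSpace τ y)
        (E4.basisVector 0) := by
  have hD : Differentiable ℝ fun z ↦ fderiv ℝ ψ z (E4.basisVector 0) :=
    ((hψ.fderiv_right (m := 1) (by norm_num)).clm_apply contDiff_const).differentiable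
      one_ne_zero
  have h1 : (fun s ↦ deriv (fun s' ↦ ψ (E4.ofTimeSpace s' y)) s) =
      fun s ↦ (fun z ↦ fderiv ℝ ψ z (E4.basisVector 0)) (E4.ofTimeSpace s y) :=
    funext fun s ↦ deriv_comp_ofTimeSpace_time (hψ.differentiable two_ne_zero) s y
  rw [h1]
  exact deriv_comp_ofTimeSpace_time hD τ y

/-- Chain rule along the coordinate line `s ↦ (τ, y + s eᵢ)`: `d/ds φ(τ, y + s eᵢ) = ∂ᵢ₊₁φ`.
[folklore] -/
private theorem deriv_comp_ofTimeSpace_line {φ : E4 → ℝ} (hφ : Differentiable ℝ φ) (τ : ℝ)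
    (y : E3) (i : Fin 3) (s : ℝ) :
    deriv (fun s' : ℝ ↦ φ (E4.ofTimeSpace τ (y + s' • EuclideanSpace.single i (1 : ℝ)))) s =
      fderiv ℝ φ (E4.ofTimeSpace τ (y + s • EuclideanSpace.single i (1 : ℝ)))
        (E4.basisVector i.succ) := by
  rw [← ofTimeSpace_zero_single]
  exact ((hφ _).hasFDerivAt.comp_hasDerivAt s (hasDerivAt_ofTimeSpace_radius τ y _ s)).deriv

/-- Second derivative along the coordinate line at the base point:
`d²/ds²|₀ ψ(τ, y + s eᵢ) = ∂ᵢ₊₁∂ᵢ₊₁ψ(τ, y)` for `ψ ∈ C²`. [folklore] -/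
private theorem deriv_deriv_comp_ofTimeSpace_line {ψ : E4 → ℝ} (hψ : ContDiff ℝ 2 ψ) (τ : ℝ)
    (y : E3) (i : Fin 3) :
    deriv (fun s : ℝ ↦ deriv
        (fun s' : ℝ ↦ ψ (E4.ofTimeSpace τ (y + s' • EuclideanSpace.single i (1 : ℝ)))) s)
        (0 : ℝ) =
      fderiv ℝ (fun z ↦ fderiv ℝ ψ z (E4.basisVector i.succ)) (E4.ofTimeSpace τ y)
        (E4.basisVector i.succ) := by
  have hD : Differentiable ℝ fun z ↦ fderiv ℝ ψ z (E4.basisVector i.succ) :=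
    ((hψ.fderiv_right (m := 1) (by norm_num)).clm_apply contDiff_const).differentiable
      one_ne_zero
  have h1 : (fun s : ℝ ↦ deriv
      (fun s' : ℝ ↦ ψ (E4.ofTimeSpace τ (y + s' • EuclideanSpace.single i (1 : ℝ)))) s) =
      fun s : ℝ ↦ (fun z ↦ fderiv ℝ ψ z (E4.basisVector i.succ))
        (E4.ofTimeSpace τ (y + s • EuclideanSpace.single i (1 : ℝ))) :=
    funext fun s ↦ deriv_comp_ofTimeSpace_line (hψ.differentiable two_ne_zero) τ y i s
  rw [h1, deriv_comp_ofTimeSpace_line hD τ y i 0, zero_smul, add_zero]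

/-- Continuity of the directional second derivatives `z ↦ ∂ᵥ'∂ᵥψ(z)` of a `C²` function.
[folklore] -/
private theorem continuous_sndDeriv_dir_C2 {ψ : E4 → ℝ} (hψ : ContDiff ℝ 2 ψ) (v v' : E4) :
    Continuous fun z ↦ fderiv ℝ (fun y ↦ fderiv ℝ ψ y v) z v' :=
  (((hψ.fderiv_right (m := 1) (by norm_num)).clm_apply contDiff_const).continuous_fderiv
    one_ne_zero).clm_apply continuous_const

/-! ### The `C²` Kirchhoff transport identity -/

/-- **Transport of the spherical means of a `C²` function** (the `1+1` reduction of Kirchhoff's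
formula, Evans, *PDE*, §2.4.1(c)): given the `C²` spherical-means calculus, for every `t, σ`,
`σ(S²) ψ(t, x) = ∫ψ(t−σ, x+σw) + σ∫Dψ(t−σ, x+σw)(0, w) + σ∫∂₀ψ(t−σ, x+σw)`
`  + ∫₀^σ (s∫∂₀∂₀ψ(t−s, x+sw) − s∫Δₓψ(t−s, x+sw)) ds` — the incoming transport identity
`transport_inRay` for the `C²` field `Ũ = rA` from `(t − σ, σ)` to `(t, 0)`. [folklore] -/
private theorem transport_sphericalMeans_C2
    (H : ∀ (ψ : E4 → ℝ), ContDiff ℝ 2 ψ → ∀ (x : E3) (A : ℝ → ℝ → ℝ), (∀ s r, A s r = ∫ (w : Metric.sphere (0 : E3) 1), ψ (E4.ofTimeSpace s (x + r • (w : E3))) ∂((volume : Measure E3).toSphere)) → ContDiff ℝ 2 (Function.uncurry A) ∧ (∀ s r, deriv (A s) r = ∫ (w : Metric.sphere (0 : E3) 1), fderiv ℝ ψ (E4.ofTimeSpace s (x + r • (w : E3))) (E4.ofTimeSpace 0 (w : E3)) ∂((volume : Measure E3).toSphere)) ∧ (∀ s r, deriv (fun s' ↦ A s' r) s = ∫ (w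 : Metric.sphere (0 : E3) 1), fderiv ℝ ψ (E4.ofTimeSpace s (x + r • (w : E3))) (E4.basisVector 0) ∂((volume : Measure E3).toSphere)) ∧ (∀ s r, iteratedDeriv 2 (fun s' ↦ A s' r) s = ∫ (w : Metric.sphere (0 : E3) 1), fderiv ℝ (fun z ↦ fderiv ℝ ψ z (E4.basisVector 0)) (E4.ofTimeSpace s (x + r • (w : E3))) (E4.basisVector 0) ∂((volume : Measure E3).toSphere)) ∧ (∀ s r, iteratedDeriv 2 (fun ρ ↦ ρ * A s ρ) r = r * ∫ (w : Metric.sphere (0 : E3) 1), (∑ i : Fin 3, fderiv ℝ (fun z ↦ fderiv ℝ ψ z (E4.basisVector i.succ)) (E4.ofTimeSpace s (x + r • (w : E3))) (E4.basisVector i.succ)) ∂((volume : Measure E3).toSphere)))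
    {ψ : E4 → ℝ} (hψ : ContDiff ℝ 2 ψ) (t : ℝ) (x : E3) (σ : ℝ) :
    ((volume : Measure E3).toSphere univ).toReal * ψ (E4.ofTimeSpace t x) =
      (∫ (w : Metric.sphere (0 : E3) 1), ψ (E4.ofTimeSpace (t - σ) (x + σ • (w : E3)))
          ∂((volume : Measure E3).toSphere)) +
      σ * (∫ (w : Metric.sphere (0 : E3) 1),
          fderiv ℝ ψ (E4.ofTimeSpace (t - σ) (x + σ • (w : E3))) (E4.ofTimeSpace 0 (w : E3))
          ∂((volume : Measure E3).toSphere)) +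
      σ * (∫ (w : Metric.sphere (0 : E3) 1),
          fderiv ℝ ψ (E4.ofTimeSpace (t - σ) (x + σ • (w : E3))) (E4.basisVector 0)
          ∂((volume : Measure E3).toSphere)) +
      ∫ s in (0 : ℝ)..σ, (s * (∫ (w : Metric.sphere (0 : E3) 1),
          fderiv ℝ (fun z ↦ fderiv ℝ ψ z (E4.basisVector 0))
            (E4.ofTimeSpace (t - s) (x + s • (w : E3))) (E4.basisVector 0)
          ∂((volume : Measure E3).toSphere)) -
        s * ∫ (w : Metric.sphere (0 : E3) 1), (∑ i : Fin 3,
          fderiv ℝ (fun z ↦ fderiv ℝ ψ z (E4.basisVector i.succ))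
            (E4.ofTimeSpace (t - s) (x + s • (w : E3))) (E4.basisVector i.succ))
          ∂((volume : Measure E3).toSphere)) := by
  -- adapted from …Theorems/StarvedNecksNecksCertifyStubKirchhoffFormula.lean
  /- the spherical means of `ψ` about `x` and their calculus (the hypothesis) -/
  obtain ⟨A, hAdef⟩ : ∃ A : ℝ → ℝ → ℝ, ∀ s r, A s r =
      ∫ (w : Metric.sphere (0 : E3) 1), ψ (E4.ofTimeSpace s (x + r • (w : E3)))
        ∂((volume : Measure E3).toSphere) :=
    ⟨_, fun _ _ ↦ rfl⟩
  obtain ⟨hA, hAr, hAs, hAss, hDarb⟩ := H ψ hψ x A hAdef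
  have hA1 : ContDiff ℝ 1 (Function.uncurry A) := hA.of_le (by norm_num)
  /- `Ũ = r A` and its slice derivatives -/
  obtain ⟨U, hUeq⟩ : ∃ U : ℝ → ℝ → ℝ, U = fun s r ↦ r * A s r := ⟨_, rfl⟩
  have hUfun : ∀ s, U s = fun ρ ↦ ρ * A s ρ := fun s ↦ by rw [hUeq]
  have hUfun' : ∀ r, (fun s ↦ U s r) = fun s ↦ r * A s r := fun r ↦ by rw [hUeq]
  have hU : ContDiff ℝ 2 (Function.uncurry U) := by
    rw [hUeq]
    exact contDiff_snd.mul hA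
  have hU1 : ContDiff ℝ 1 (Function.uncurry U) := hU.of_le (by norm_num)
  have hUt : ∀ s r, fderiv ℝ (Function.uncurry U) (s, r) (1, 0) =
      r * deriv (fun s' ↦ A s' r) s := fun s r ↦ by
    rw [← deriv_time_eq hU1 s r, hUfun' r]
    exact deriv_const_mul_field r
  have hUr : ∀ s r, fderiv ℝ (Function.uncurry U) (s, r) (0, 1) =
      A s r + r * deriv (A s) r := fun s r ↦ by
    rw [← deriv_space_eq hU1 s r, hUfun s]
    have h : HasDerivAt (fun ρ ↦ ρ * A s ρ) (1 * A s r + r * deriv (A s) r) r :=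
      (hasDerivAt_id' r).mul (hasDerivAt_space hA1 s r).differentiableAt.hasDerivAt
    rw [h.deriv, one_mul]
  have hUtt : ∀ s r, fderiv ℝ (fderiv ℝ (Function.uncurry U)) (s, r) (1, 0) (1, 0) =
      r * iteratedDeriv 2 (fun s' ↦ A s' r) s := fun s r ↦ by
    rw [← iteratedDeriv_time_eq_snd hU s r, hUfun' r]
    exact iteratedDeriv_const_mul_field r _
  have hUrr : ∀ s r, fderiv ℝ (fderiv ℝ (Function.uncurry U)) (s, r) (0, 1) (0, 1) =
      iteratedDeriv 2 (fun ρ ↦ ρ * A s ρ) r := fun s r ↦ by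
    rw [← iteratedDeriv_space_eq_snd hU s r, hUfun s]
  /- the apex value: `A(t, 0) = σ(S²) ψ(t, x)` -/
  have hA0 : A t 0 = ((volume : Measure E3).toSphere univ).toReal * ψ (E4.ofTimeSpace t x) := by
    rw [hAdef]
    simp only [zero_smul, add_zero, integral_const, smul_eq_mul, measureReal_def]
  /- transport of `Ũₛ + Ũᵣ` along the incoming characteristic from `(t - σ, σ)` to `(t, 0)` -/
  have htr := transport_inRay hU t 0 σ
  simp only [zero_add, hUt, hUr, hUtt, hUrr, zero_mul, add_zero, hAs, hAr, hAss, hDarb,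
    hA0] at htr
  rw [hAdef (t - σ) σ] at htr
  linear_combination htr

/-- **Kirchhoff–Duhamel with zero data at `s = 1`, `C²` version**: if `ψ(1, ·) = 0` and
`∂₀ψ(1, ·) = 0`, then `σ(S²) ψ(t, x) = ∫₀^{t−1} (s∫∂₀∂₀ψ(t−s, x+sw) − s∫Δₓψ(t−s, x+sw)) ds`:
the transport identity with `σ = t − 1`, all three data terms vanishing (the spatial derivative
of the vanishing slice by `fderiv_space_eq_zero_of_slice_vanishes`). [folklore] -/
private theorem kirchhoff_zeroData_C2
    (H : ∀ (ψ : E4 → ℝ), ContDiff ℝ 2 ψ → ∀ (x : E3) (A : ℝ → ℝ → ℝ), (∀ s r, A s r = ∫ (w : Metric.sphere (0 : E3) 1), ψ (E4.ofTimeSpace s (x + r • (w : E3))) ∂((volume : Measure E3).toSphere)) → ContDiff ℝ 2 (Function.uncurry A) ∧ (∀ s r, deriv (A s) r = ∫ (w : Metric.sphere (0 : E3) 1), fderiv ℝ ψ (E4.ofTimeSpace s (x + r • (w : E3))) (E4.ofTimeSpace 0 (w : E3)) ∂((volume : Measure E3).toSphere)) ∧ (∀ s r, deriv (fun s' ↦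 A s' r) s = ∫ (w : Metric.sphere (0 : E3) 1), fderiv ℝ ψ (E4.ofTimeSpace s (x + r • (w : E3))) (E4.basisVector 0) ∂((volume : Measure E3).toSphere)) ∧ (∀ s r, iteratedDeriv 2 (fun s' ↦ A s' r) s = ∫ (w : Metric.sphere (0 : E3) 1), fderiv ℝ (fun z ↦ fderiv ℝ ψ z (E4.basisVector 0)) (E4.ofTimeSpace s (x + r • (w : E3))) (E4.basisVector 0) ∂((volume : Measure E3).toSphere)) ∧ (∀ s r, iteratedDeriv 2 (fun ρ ↦ ρ * A s ρ) r = r * ∫ (w : Metric.sphere (0 : E3) 1), (∑ i : Fin 3, fderiv ℝ (fun z ↦ fderiv ℝ ψ z (E4.basisVector i.succ)) (E4.ofTimeSpace s (x + r • (w : E3))) (E4.basisVector i.succ)) ∂((volume : Measure E3).toSphere)))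
    {ψ : E4 → ℝ} (hψ : ContDiff ℝ 2 ψ) (h0 : ∀ y, ψ (E4.ofTimeSpace 1 y) = 0)
    (h0' : ∀ y, fderiv ℝ ψ (E4.ofTimeSpace 1 y) (E4.basisVector 0) = 0) (t : ℝ) (x : E3) :
    ((volume : Measure E3).toSphere univ).toReal * ψ (E4.ofTimeSpace t x) =
      ∫ s in (0 : ℝ)..(t - 1), (s * (∫ (w : Metric.sphere (0 : E3) 1),
          fderiv ℝ (fun z ↦ fderiv ℝ ψ z (E4.basisVector 0))
            (E4.ofTimeSpace (t - s) (x + s • (w : E3))) (E4.basisVector 0)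
          ∂((volume : Measure E3).toSphere)) -
        s * ∫ (w : Metric.sphere (0 : E3) 1), (∑ i : Fin 3,
          fderiv ℝ (fun z ↦ fderiv ℝ ψ z (E4.basisVector i.succ))
            (E4.ofTimeSpace (t - s) (x + s • (w : E3))) (E4.basisVector i.succ))
          ∂((volume : Measure E3).toSphere)) := by
  have h := transport_sphericalMeans_C2 H hψ t x (t - 1)
  have hsp : ∀ (y v : E3), fderiv ℝ ψ (E4.ofTimeSpace 1 y) (E4.ofTimeSpace 0 v) = 0 :=
    fun y v ↦ fderiv_space_eq_zero_of_slice_vanishes (hψ.differentiable two_ne_zero)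
      isOpen_univ 1 (fun y _ ↦ h0 y) (mem_univ y) v
  simp only [sub_sub_cancel, h0, h0', hsp, integral_zero, mul_zero, add_zero, zero_add] at h
  exact h

/-! ### The Kirchhoff–Duhamel formula, equality form -/

/-- **Kirchhoff–Duhamel with zero Cauchy data at `t = 1`** (equality form, Evans, *PDE*,
§2.4.1(c), §2.4.2): for `u ∈ C²(ℝ × E3)` with `u(1, ·) = 0`, `∂ₜu(1, ·) = 0` and
`u_tt = Δu + f` on `t ≥ 1` (iterated-`deriv` d'Alembertian),
`u(t, x) = σ(S²)⁻¹ ∫₀^{t−1} s ∫_{S²} f(t − s, x + s w) dσ(w) ds` for `t ≥ 1`. [folklore] -/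
theorem kirchhoff_duhamel_eq (u f : ℝ → E3 → ℝ) (hu : ContDiff ℝ 2 (fun p : ℝ × E3 ↦ u p.1 p.2))
    (h0 : ∀ x, u 1 x = 0 ∧ deriv (fun s ↦ u s x) 1 = 0)
    (hpde : ∀ t x, 1 ≤ t → deriv (fun s ↦ deriv (fun s' ↦ u s' x) s) t =
      ∑ i : Fin 3, deriv (fun s : ℝ ↦ deriv (fun s' : ℝ ↦
        u t (x + s' • EuclideanSpace.single i (1 : ℝ))) s) (0 : ℝ) + f t x)
    (t : ℝ) (x : E3) (ht : 1 ≤ t) :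
    u t x = (((volume : Measure E3).toSphere univ).toReal)⁻¹ *
      ∫ s in (0 : ℝ)..(t - 1), s * ∫ (w : Metric.sphere (0 : E3) 1),
        f (t - s) (x + s • (w : E3)) ∂((volume : Measure E3).toSphere) := by
  -- adapted from …Theorems/EIHFluxBalanceModulatedKerrHandoffStubKirchhoffComparisonC2.lean
  have H : (∀ (ψ : E4 → ℝ), ContDiff ℝ 2 ψ → ∀ (x : E3) (A : ℝ → ℝ → ℝ), (∀ s r, A s r = ∫ (w : Metric.sphere (0 : E3) 1), ψ (E4.ofTimeSpace s (x + r • (w : E3))) ∂((volume : Measure E3).toSphere)) → ContDiff ℝ 2 (Function.uncurry A) ∧ (∀ s r, deriv (A s) r = ∫ (w : Metric.sphere (0 : E3) 1), fderiv ℝ ψ (E4.ofTimeSpace s (x + r • (w : E3))) (E4.ofTimeSpace 0 (w : E3)) ∂((volume : Measure E3).toSphere)) ∧ (∀ s r, deriv (fun s' ↦ A s' r) s = ∫ (w : Metric.sphere (0 : E3) 1), fderiv ℝ ψ (E4.ofTimeSpace s (x + r • (w : E3))) (E4.basisVector 0) ∂((volume : Measure E3).toSphere)) ∧ (∀ s r,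 iteratedDeriv 2 (fun s' ↦ A s' r) s = ∫ (w : Metric.sphere (0 : E3) 1), fderiv ℝ (fun z ↦ fderiv ℝ ψ z (E4.basisVector 0)) (E4.ofTimeSpace s (x + r • (w : E3))) (E4.basisVector 0) ∂((volume : Measure E3).toSphere)) ∧ (∀ s r, iteratedDeriv 2 (fun ρ ↦ ρ * A s ρ) r = r * ∫ (w : Metric.sphere (0 : E3) 1), (∑ i : Fin 3, fderiv ℝ (fun z ↦ fderiv ℝ ψ z (E4.basisVector i.succ)) (E4.ofTimeSpace s (x + r • (w : E3))) (E4.basisVector i.succ)) ∂((volume : Measure E3).toSphere))) := stub_sphericalMeansCalculusC2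
  /- the `C²` function `ψ(z) = u(z⁰, spatial z)` on `E4` and its slices -/
  obtain ⟨ψ, hψdef⟩ : ∃ ψ : E4 → ℝ, ∀ z, ψ z = u (z 0) (E4.spatial z) := ⟨_, fun _ ↦ rfl⟩
  have hψeval : ∀ (s : ℝ) (y : E3), ψ (E4.ofTimeSpace s y) = u s y := fun s y ↦ by
    rw [hψdef, E4.ofTimeSpace_apply_zero, E4.spatial_ofTimeSpace]
  have hψ2 : ContDiff ℝ 2 ψ := by
    have hfun : ψ = (fun p : ℝ × E3 ↦ u p.1 p.2) ∘ fun z : E4 ↦ (z 0, E4.spatial z) :=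
      funext fun z ↦ hψdef z
    rw [hfun]
    exact hu.comp ((contDiff_piLp_apply (𝕜 := ℝ) (p := 2) (n := 2) (i := (0 : Fin 4))).prodMk
      E4.spatial.contDiff)
  have hdiff : Differentiable ℝ ψ := hψ2.differentiable two_ne_zero
  /- dictionary: the slice derivatives of `u` are coordinate derivatives of `ψ` -/
  have ht1 : ∀ y, deriv (fun s ↦ u s y) 1 = fderiv ℝ ψ (E4.ofTimeSpace 1 y) (E4.basisVector 0) :=
    fun y ↦ by
    rw [← deriv_comp_ofTimeSpace_time hdiff 1 y]
    simp only [hψeval]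
  have htt : ∀ τ y, deriv (fun s ↦ deriv (fun s' ↦ u s' y) s) τ =
      fderiv ℝ (fun z ↦ fderiv ℝ ψ z (E4.basisVector 0)) (E4.ofTimeSpace τ y)
        (E4.basisVector 0) := fun τ y ↦ by
    rw [← deriv_deriv_comp_ofTimeSpace_time hψ2 τ y]
    simp only [hψeval]
  have hlap : ∀ τ y (i : Fin 3),
      deriv (fun s : ℝ ↦ deriv (fun s' : ℝ ↦ u τ (y + s' • EuclideanSpace.single i (1 : ℝ))) s)
        (0 : ℝ) =
      fderiv ℝ (fun z ↦ fderiv ℝ ψ z (E4.basisVector i.succ)) (E4.ofTimeSpace τ y)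
        (E4.basisVector i.succ) := fun τ y i ↦ by
    rw [← deriv_deriv_comp_ofTimeSpace_line hψ2 τ y i]
    simp only [hψeval]
  /- zero data at `s = 1` and the equation `∂₀∂₀ψ − Δₓψ = f` on `τ ≥ 1`, for `ψ` -/
  have h0ψ : ∀ y, ψ (E4.ofTimeSpace 1 y) = 0 := fun y ↦ (hψeval 1 y).trans (h0 y).1
  have h0ψ' : ∀ y, fderiv ℝ ψ (E4.ofTimeSpace 1 y) (E4.basisVector 0) = 0 := fun y ↦
    (ht1 y).symm.trans (h0 y).2
  have hpdeψ : ∀ (τ : ℝ) (y : E3), 1 ≤ τ →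
      fderiv ℝ (fun z ↦ fderiv ℝ ψ z (E4.basisVector 0)) (E4.ofTimeSpace τ y)
          (E4.basisVector 0) -
        ∑ i : Fin 3, fderiv ℝ (fun z ↦ fderiv ℝ ψ z (E4.basisVector i.succ))
          (E4.ofTimeSpace τ y) (E4.basisVector i.succ) = f τ y := fun τ y hτ ↦ by
    rw [← htt τ y, hpde τ y hτ]
    simp only [hlap]
    ring
  /- Kirchhoff–Duhamel with zero data: `σ(S²) u(t, x) = ∫₀^{t-1} s ∫ f(t−s, x+sw) dσ ds` -/
  have hK := kirchhoff_zeroData_C2 H hψ2 h0ψ h0ψ' t x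
  rw [hψeval] at hK
  have hpt : ∀ s : ℝ, Continuous (fun y : E3 ↦ E4.ofTimeSpace (t - s) (x + s • y)) := fun s ↦
    (E4.continuous_ofTimeSpace _).comp (continuous_const.add (continuous_const_smul s))
  have hEq : EqOn (fun s : ℝ ↦ s * (∫ (w : Metric.sphere (0 : E3) 1),
          fderiv ℝ (fun z ↦ fderiv ℝ ψ z (E4.basisVector 0))
            (E4.ofTimeSpace (t - s) (x + s • (w : E3))) (E4.basisVector 0)
          ∂((volume : Measure E3).toSphere)) -
        s * ∫ (w : Metric.sphere (0 : E3) 1), (∑ i : Fin 3,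
          fderiv ℝ (fun z ↦ fderiv ℝ ψ z (E4.basisVector i.succ))
            (E4.ofTimeSpace (t - s) (x + s • (w : E3))) (E4.basisVector i.succ))
          ∂((volume : Measure E3).toSphere))
      (fun s : ℝ ↦ s * ∫ (w : Metric.sphere (0 : E3) 1), f (t - s) (x + s • (w : E3))
          ∂((volume : Measure E3).toSphere)) (uIcc 0 (t - 1)) := by
    intro s hs
    rw [uIcc_of_le (sub_nonneg.mpr ht)] at hs
    have hτ : 1 ≤ t - s := by linarith [hs.2]
    have hi1 : Integrable (fun w : Metric.sphere (0 : E3) 1 ↦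
        fderiv ℝ (fun z ↦ fderiv ℝ ψ z (E4.basisVector 0))
          (E4.ofTimeSpace (t - s) (x + s • (w : E3))) (E4.basisVector 0))
        ((volume : Measure E3).toSphere) :=
      integrable_sphere_of_continuous ((continuous_sndDeriv_dir_C2 hψ2 _ _).comp (hpt s))
    have hi2 : Integrable (fun w : Metric.sphere (0 : E3) 1 ↦ ∑ i : Fin 3,
        fderiv ℝ (fun z ↦ fderiv ℝ ψ z (E4.basisVector i.succ))
          (E4.ofTimeSpace (t - s) (x + s • (w : E3))) (E4.basisVector i.succ))
        ((volume : Measure E3).toSphere) :=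
      integrable_sphere_of_continuous
        (continuous_finsetSum _ fun i _ ↦ (continuous_sndDeriv_dir_C2 hψ2 _ _).comp (hpt s))
    simp only
    rw [← mul_sub, ← integral_sub hi1 hi2]
    congr 1
    exact integral_congr_ae (ae_of_all _ fun w ↦ hpdeψ (t - s) (x + s • (w : E3)) hτ)
  rw [intervalIntegral.integral_congr hEq] at hK
  set c : ℝ := ((volume : Measure E3).toSphere univ).toReal with hc
  have hc0 : c ≠ 0 := by
    rw [hc]
    exact toSphere_univ_toReal_ne_zero
  have hu_eq : u t x = c⁻¹ * ∫ s in (0 : ℝ)..(t - 1), s * ∫ (w : Metric.sphere (0 : E3) 1),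
      f (t - s) (x + s • (w : E3)) ∂((volume : Measure E3).toSphere) := by
    rw [← hK, ← mul_assoc, inv_mul_cancel₀ hc0, one_mul]
  exact hu_eq

/-! ### Registered form -/

/-- **Kirchhoff–Duhamel with zero data, equality form** (registered helper of
stmt-FinalStateConjecture-17402, brick `FarConeRetardationRemainder`). [folklore] -/
theorem farCone_kirchhoff_duhamel_eq : open Literature.Geometry.Lorentzian MeasureTheory Metric in ∀ (u f : ℝ → E3 → ℝ), ContDiff ℝ 2 (fun p : ℝ × E3 ↦ u p.1 p.2) → (∀ x, u 1 x = 0 ∧ deriv (fun s ↦ u s x) 1 = 0) → (∀ t x, 1 ≤ t → deriv (fun s ↦ deriv (fun s' ↦ u s' x) s) t = ∑ i : Fin 3, deriv (fun s : ℝ ↦ deriv (fun s' : ℝ ↦ u t (x + s' • EuclideanSpace.single i (1 : ℝ))) s) (0 : ℝ) + f t x) → ∀ (t : ℝ) (x : E3), 1 ≤ t → u t x = (((volume : Measure E3).toSphere Set.univ).toReal)⁻¹ * ∫ s in (0 : ℝ)..(t - 1), s * ∫ (w : Metric.sphere (0 : E3) 1), f (t - s) (x + s • (w : E3)) ∂((volume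 : Measure E3).toSphere) :=
  fun u f hu h0 hpde t x ht ↦ kirchhoff_duhamel_eq u f hu h0 hpde t x ht

end Summit.FinalStateConjecture.FinalStateConjecture.Theorems.EIHFluxBalance.ModulatedKerrHandoffBricks.FarCone

end
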